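import Mathlib
import Summits.MatrixMultiplication.MatrixMultiplication.Theorems.SnSubsetDichotomyPolynomialSlackEntropyCertificate
import Summits.MatrixMultiplication.MatrixMultiplication.Theorems.SnSubsetDichotomyPolynomialSlackMarginals

/-!
# `SnSubsetDichotomy.PolynomialSlack`, line `transport-split-hull` — the certificate on level blocks

Crux `Summit.MatrixMultiplication.MatrixMultiplication.Theses.SnSubsetDichotomy.PolynomialSlack`
(item `stmt-MatrixMultiplication-8306`), level-one programme on triples `S, T, U ⊆ S_n` with the
triple product property, lead c9, line `transport-split-hull`: the registered stub
`certificate_levels` (F4), the entropy certificate `log_density_ge_certificate` of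
`…EntropyCertificate` evaluated with the optimal weights on the dyadic LEVEL BLOCKS of a pair
profile.

Setting.  For `X, Y ⊆ S_n` with `(x,y) ↦ x⁻¹y` injective on `X × Y`, the quotient set `A = X⁻¹Y`
has `|A| = |X||Y|` (`card_image₂_of_injOn'`) and profile
`d(i,j) = #{(x,y) : y j = x i}/(|X||Y|) = P_A(a j = i)` (`pairMarginal_eq_marginal_image₂`).  An
ATOM is a pair `p = (k, ℓ)` of a position `k` and a dyadic level `ℓ`; its level block is
`Blk p = {i : θ ≤ d(i,k), ⌊log₂ (1/d(i,k))⌋ = ℓ}`, its mass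
`σ p = ∑_{i ∈ Blk p} d(i,k) = P_A(a k ∈ Blk p)` and its width `x p = max |Blk p| 1`.  For a
family `Inc` of atoms with masses `σ p ≥ ε`, total mass `S = ∑ σ p`, and few positions
(`2|P|² ≤ n`, `P` the set of positions of `Inc`):

* `certificate_blocks` — the analytic core, for any non-empty `A ⊆ S_n` and any block family in
  which two blocks at the same position containing a common value coincide:
  `∑_{p ∈ Inc} σ p · (log n − log x p) ≤ log (n!/|A|) + S · log (S/ε) + 2`.
  Proof: apply `log_density_ge_certificate` to `A`, `P` and the weights
  `φ k v = λ p` for `v ∈ Blk p`, `p = (k, ℓ) ∈ Inc`, `φ k v = 1` otherwise, where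
  `λ p = max 1 (n σ p/(x p S))`.  Its left side is exactly `∑_p σ p log λ p ≥
  ∑_p σ p (log n − log x p) − S log (S/ε)` (as `σ p ≥ ε`); on the right,
  `log ((∑_v φ k v)/n) ≤ ∑_{p at k} (λ p − 1)|Blk p|/n ≤ ∑_{p at k} σ p/S` sums to `≤ 1` over
  `k ∈ P`, and `|P| log (n/(n − |P|)) ≤ |P|²/(n − |P|) ≤ 1`.
* `certificate_levels` — the registered form for the level blocks of the profile of a pair
  `(X, Y)`, via the dictionary above.

Mathlib and the two programme files only.
-/

-- `Summit.<Summit>.<Problem>` is the tree's mandated summit-side namespace; for this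
-- single-conjunct summit the two coincide, so the file silences `dupNamespace`.
set_option linter.dupNamespace false

open scoped BigOperators

namespace Summit.MatrixMultiplication.MatrixMultiplication.Theorems.PolynomialSlack

/-- **Entropy certificate on a block family (analytic core of `certificate_levels`).**  Let
`A ⊆ S_n` be non-empty (`n ≥ 2`), `d(i,j) = #{a ∈ A : a j = i}/|A|` its profile, and `B` a family of
blocks of values indexed by atoms `p = (k, ℓ)` (position `k`, label `ℓ`) such that two blocks at the
same position sharing a value coincide.  For a finite set `Inc` of atoms with masses
`σ p = ∑_{i ∈ B p} d(i,k) ≥ ε > 0`, widths `x p = max |B p| 1`, total mass `S = ∑_{Inc} σ p` and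
position set `P` with `2|P|² ≤ n`:
`∑_{p ∈ Inc} σ p (log n − log x p) ≤ log (n!/|A|) + S log (S/ε) + 2`.
Proof: `log_density_ge_certificate` with the weights `φ k v = max 1 (n σ p/(x p S))` on `v ∈ B p`
(`p ∈ Inc` at position `k`) and `1` elsewhere; see the module docstring. [folklore] -/
theorem certificate_blocks {n m : ℕ} (hn : 2 ≤ n) (A : Finset (Equiv.Perm (Fin n)))
    (hA : A.Nonempty) (d : Fin n → Fin n → ℝ)
    (hd : ∀ i j, d i j = ((A.filter fun a => a j = i).card : ℝ) / A.card)
    (B : Fin n × Fin m → Finset (Fin n))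
    (hB : ∀ p q : Fin n × Fin m, p.1 = q.1 → ∀ i ∈ B p, i ∈ B q → p = q)
    (Inc : Finset (Fin n × Fin m)) (ε : ℝ) (hε : 0 < ε)
    (hεσ : ∀ p ∈ Inc, ε ≤ ∑ i ∈ B p, d i p.1)
    (hP : 2 * ((Inc.image Prod.fst).card : ℝ) ^ 2 ≤ n) :
    ∑ p ∈ Inc, (∑ i ∈ B p, d i p.1) * (Real.log n - Real.log (max ((B p).card : ℝ) 1)) ≤
      Real.log ((n.factorial : ℝ) / A.card) +
        (∑ p ∈ Inc, ∑ i ∈ B p, d i p.1) *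
          Real.log ((∑ p ∈ Inc, ∑ i ∈ B p, d i p.1) / ε) + 2 := by
  classical
  -- fold the masses `σ p` and the widths `x p`
  obtain ⟨σ, hσ⟩ : ∃ σ : Fin n × Fin m → ℝ, ∀ p, σ p = ∑ i ∈ B p, d i p.1 := ⟨_, fun _ => rfl⟩
  obtain ⟨x, hx⟩ : ∃ x : Fin n × Fin m → ℝ, ∀ p, x p = max ((B p).card : ℝ) 1 :=
    ⟨_, fun _ => rfl⟩
  simp only [← hσ, ← hx]
  set P : Finset (Fin n) := Inc.image Prod.fst with hP_def
  set S : ℝ := ∑ p ∈ Inc, σ p with hS_def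
  /- (0) positivity bookkeeping -/
  have hAc : (0 : ℝ) < A.card := Nat.cast_pos.2 hA.card_pos
  have hnR : (2 : ℝ) ≤ n := by exact_mod_cast hn
  have hn0 : (0 : ℝ) < n := by linarith
  have hd0 : ∀ i j, 0 ≤ d i j := fun i j => by
    rw [hd]
    exact div_nonneg (Nat.cast_nonneg _) hAc.le
  have hσ0 : ∀ p, 0 ≤ σ p := fun p => by
    rw [hσ]
    exact Finset.sum_nonneg fun i _ => hd0 i p.1
  have hσε : ∀ p ∈ Inc, ε ≤ σ p := fun p hp => by
    rw [hσ]
    exact hεσ p hp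
  have hσpos : ∀ p ∈ Inc, 0 < σ p := fun p hp => hε.trans_le (hσε p hp)
  have hσS : ∀ p ∈ Inc, σ p ≤ S := fun p hp => Finset.single_le_sum (fun q _ => hσ0 q) hp
  have hSpos : ∀ p ∈ Inc, 0 < S := fun p hp => (hσpos p hp).trans_le (hσS p hp)
  have hx1 : ∀ p, 1 ≤ x p := fun p => by
    rw [hx]
    exact le_max_right _ _
  have hx0 : ∀ p, 0 < x p := fun p => one_pos.trans_le (hx1 p)
  have hBx : ∀ p, ((B p).card : ℝ) ≤ x p := fun p => by
    rw [hx]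
    exact le_max_left _ _
  /- (1) the weights `λ p = max 1 (n σ p / (x p S))` and
  `φ k v = 1 + ∑_{p ∈ Inc at position k} [v ∈ B p] (λ p - 1)` -/
  set lam : Fin n × Fin m → ℝ := fun p => max 1 (n * σ p / (x p * S)) with hlam_def
  have hlam1 : ∀ p, 1 ≤ lam p := fun p => le_max_left _ _
  have ht0 : ∀ p ∈ Inc, 0 < n * σ p / (x p * S) := fun p hp =>
    div_pos (mul_pos hn0 (hσpos p hp)) (mul_pos (hx0 p) (hSpos p hp))
  have hlamt : ∀ p, n * σ p / (x p * S) ≤ lam p := fun p => le_max_right _ _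
  have hlamsub : ∀ p ∈ Inc, lam p - 1 ≤ n * σ p / (x p * S) := fun p hp => by
    rw [sub_le_iff_le_add]
    exact max_le (by linarith [ht0 p hp]) (by linarith)
  set φ : Fin n → Fin n → ℝ := fun k v =>
    1 + ∑ p ∈ Inc.filter (fun p => p.1 = k), if v ∈ B p then lam p - 1 else 0 with hφ_def
  have hφ1 : ∀ k v, 1 ≤ φ k v := fun k v => by
    simp only [hφ_def]
    refine le_add_of_nonneg_right (Finset.sum_nonneg fun p _ => ?_)
    split_ifs
    · linarith [hlam1 p]
    · exact le_rfl
  -- at most one block at position `k` contains the value `v`, so `log φ k v` is additive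
  have hlogφ : ∀ k v, Real.log (φ k v) =
      ∑ p ∈ Inc.filter (fun p => p.1 = k), if v ∈ B p then Real.log (lam p) else 0 := by
    intro k v
    simp only [hφ_def]
    by_cases h : ∃ p ∈ Inc.filter (fun p => p.1 = k), v ∈ B p
    · obtain ⟨p, hp, hv⟩ := h
      have huniq : ∀ q ∈ Inc.filter (fun p => p.1 = k), q ≠ p → v ∉ B q :=
        fun q hq hne hvq => hne (hB q p
          ((Finset.mem_filter.1 hq).2.trans (Finset.mem_filter.1 hp).2.symm) v hvq hv)
      rw [Finset.sum_eq_single_of_mem p hp fun q hq hne => if_neg (huniq q hq hne),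
        Finset.sum_eq_single_of_mem p hp fun q hq hne => if_neg (huniq q hq hne),
        if_pos hv, if_pos hv, add_sub_cancel]
    · have h' : ∀ q ∈ Inc.filter (fun p => p.1 = k), v ∉ B q := fun q hq hvq => h ⟨q, hq, hvq⟩
      rw [Finset.sum_eq_zero fun q hq => if_neg (h' q hq),
        Finset.sum_eq_zero fun q hq => if_neg (h' q hq), add_zero, Real.log_one]
  /- (2) the certificate -/
  have hPn : P.card < n := by
    by_contra h
    have h' : (n : ℝ) ≤ P.card := by exact_mod_cast not_lt.1 h
    nlinarith
  have hcert := log_density_ge_certificate A hA P hPn φ hφ1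
  /- (3) its left-hand side is `∑_{p ∈ Inc} σ p log λ p` -/
  have hcnt : ∀ i j, ((A.filter fun a => a j = i).card : ℝ) = A.card * d i j := fun i j => by
    rw [hd]
    exact (mul_div_cancel₀ _ hAc.ne').symm
  have hpt : ∀ a : Equiv.Perm (Fin n), ∑ k ∈ P, Real.log (φ k (a k)) =
      ∑ p ∈ Inc, if a p.1 ∈ B p then Real.log (lam p) else 0 := by
    intro a
    symm
    rw [← Finset.sum_fiberwise_of_maps_to (t := P) (g := Prod.fst)
      (fun p hp => Finset.mem_image_of_mem Prod.fst hp)]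
    refine Finset.sum_congr rfl fun k _ => ?_
    rw [hlogφ]
    refine Finset.sum_congr rfl fun p hp => ?_
    rw [(Finset.mem_filter.1 hp).2]
  have hblock : ∀ p, ∑ a ∈ A, (if a p.1 ∈ B p then Real.log (lam p) else 0) =
      A.card * (σ p * Real.log (lam p)) := by
    intro p
    rw [← Finset.sum_filter, Finset.sum_const, nsmul_eq_mul, ← mul_assoc]
    congr 1
    rw [Finset.card_eq_sum_card_fiberwise (f := fun a : Equiv.Perm (Fin n) => a p.1)
      (s := A.filter fun a => a p.1 ∈ B p) (t := B p)
      (fun a ha => Finset.mem_coe.2 (Finset.mem_filter.1 (Finset.mem_coe.1 ha)).2)]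
    push_cast
    rw [hσ, Finset.mul_sum]
    refine Finset.sum_congr rfl fun i hi => ?_
    rw [← hcnt]
    congr 2
    ext a
    simp only [Finset.mem_filter]
    exact ⟨fun h => ⟨h.1.1, h.2⟩, fun h => ⟨⟨h.1, h.2 ▸ hi⟩, h.2⟩⟩
  have hL : (∑ a ∈ A, ∑ k ∈ P, Real.log (φ k (a k))) / A.card =
      ∑ p ∈ Inc, σ p * Real.log (lam p) := by
    rw [Finset.sum_congr rfl fun a _ => hpt a, Finset.sum_comm,
      Finset.sum_congr rfl fun p _ => hblock p, ← Finset.mul_sum, mul_div_cancel_left₀ _ hAc.ne']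
  -- ... which dominates the claimed left side minus `S log (S/ε)`
  have hlow : ∀ p ∈ Inc, σ p * (Real.log n - Real.log (x p)) - σ p * Real.log (S / ε) ≤
      σ p * Real.log (lam p) := by
    intro p hp
    have h1 : Real.log (n * σ p / (x p * S)) ≤ Real.log (lam p) :=
      Real.log_le_log (ht0 p hp) (hlamt p)
    have h2 : Real.log (n * σ p / (x p * S)) =
        Real.log n + Real.log (σ p) - (Real.log (x p) + Real.log S) := by
      rw [Real.log_div (mul_pos hn0 (hσpos p hp)).ne' (mul_pos (hx0 p) (hSpos p hp)).ne',
        Real.log_mul hn0.ne' (hσpos p hp).ne', Real.log_mul (hx0 p).ne' (hSpos p hp).ne']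
    have h3 : Real.log (S / ε) = Real.log S - Real.log ε := Real.log_div (hSpos p hp).ne' hε.ne'
    have h4 : Real.log ε ≤ Real.log (σ p) := Real.log_le_log hε (hσε p hp)
    have key : Real.log n - Real.log (x p) - Real.log (S / ε) ≤ Real.log (lam p) := by
      rw [h3]
      linarith
    have := mul_le_mul_of_nonneg_left key (hσ0 p)
    linarith
  have hsum_low : ∑ p ∈ Inc, σ p * (Real.log n - Real.log (x p)) - S * Real.log (S / ε) ≤
      ∑ p ∈ Inc, σ p * Real.log (lam p) := by
    have hSmul : S * Real.log (S / ε) = ∑ p ∈ Inc, σ p * Real.log (S / ε) := by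
      rw [hS_def, Finset.sum_mul]
    rw [hSmul, ← Finset.sum_sub_distrib]
    exact Finset.sum_le_sum hlow
  /- (4) the right-hand side: the column sums ... -/
  have huniv : (Finset.univ : Finset (Fin n)).Nonempty := ⟨⟨0, by omega⟩, Finset.mem_univ _⟩
  have hcol : ∀ k ∈ P, Real.log ((∑ v, φ k v) / n) ≤
      ∑ p ∈ Inc.filter (fun p => p.1 = k), σ p / S := by
    intro k _
    have hsumφ : ∑ v, φ k v =
        n + ∑ p ∈ Inc.filter (fun p => p.1 = k), (B p).card * (lam p - 1) := by
      simp only [hφ_def]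
      rw [Finset.sum_add_distrib, Finset.sum_const, Finset.card_univ, Fintype.card_fin,
        nsmul_eq_mul, mul_one, Finset.sum_comm]
      congr 1
      refine Finset.sum_congr rfl fun p _ => ?_
      rw [Finset.sum_ite_mem, Finset.univ_inter, Finset.sum_const, nsmul_eq_mul]
    have hbd : ∑ p ∈ Inc.filter (fun p => p.1 = k), ((B p).card : ℝ) * (lam p - 1) ≤
        ∑ p ∈ Inc.filter (fun p => p.1 = k), n * (σ p / S) := by
      refine Finset.sum_le_sum fun p hp => ?_
      have hpI : p ∈ Inc := (Finset.mem_filter.1 hp).1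
      calc ((B p).card : ℝ) * (lam p - 1) ≤ x p * (n * σ p / (x p * S)) :=
            mul_le_mul (hBx p) (hlamsub p hpI) (by linarith [hlam1 p]) (hx0 p).le
        _ = n * (σ p / S) := by
            rw [← mul_div_assoc, mul_div_mul_left _ _ (hx0 p).ne', mul_div_assoc]
    have hpos : 0 < ∑ v, φ k v :=
      Finset.sum_pos (fun v _ => one_pos.trans_le (hφ1 k v)) huniv
    calc Real.log ((∑ v, φ k v) / n) ≤ (∑ v, φ k v) / n - 1 :=
          Real.log_le_sub_one_of_pos (div_pos hpos hn0)
      _ = (∑ p ∈ Inc.filter (fun p => p.1 = k), ((B p).card : ℝ) * (lam p - 1)) / n := by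
          rw [hsumφ, div_sub_one hn0.ne', add_sub_cancel_left]
      _ ≤ (∑ p ∈ Inc.filter (fun p => p.1 = k), n * (σ p / S)) / n :=
          div_le_div_of_nonneg_right hbd hn0.le
      _ = ∑ p ∈ Inc.filter (fun p => p.1 = k), σ p / S := by
          rw [← Finset.mul_sum, mul_div_cancel_left₀ _ hn0.ne']
  -- ... sum to at most `S/S ≤ 1` over the positions
  have hB1 : ∑ k ∈ P, Real.log ((∑ v, φ k v) / n) ≤ 1 := by
    refine (Finset.sum_le_sum hcol).trans ?_
    rw [Finset.sum_fiberwise_of_maps_to (t := P) (g := Prod.fst)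
      (fun p hp => Finset.mem_image_of_mem Prod.fst hp), ← Finset.sum_div]
    exact div_self_le_one S
  -- ... and the injectivity defect `|P| log (n/(n-|P|)) ≤ |P|²/(n-|P|) ≤ 1`
  have hB2 : (P.card : ℝ) * Real.log ((n : ℝ) / (n - P.card)) ≤ 1 := by
    have hr : (P.card : ℝ) < n := by exact_mod_cast hPn
    have hnr : (0 : ℝ) < n - P.card := sub_pos.2 hr
    have hr2 : (P.card : ℝ) ^ 2 + P.card ≤ n := by
      rcases Nat.eq_zero_or_pos P.card with h0 | h1
      · rw [h0, Nat.cast_zero]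
        linarith
      · have h1' : (1 : ℝ) ≤ P.card := by exact_mod_cast h1
        nlinarith
    have hlog : Real.log ((n : ℝ) / (n - P.card)) ≤ P.card / (n - P.card) := by
      calc Real.log ((n : ℝ) / (n - P.card)) ≤ (n : ℝ) / (n - P.card) - 1 :=
            Real.log_le_sub_one_of_pos (div_pos hn0 hnr)
        _ = P.card / (n - P.card) := by
            rw [div_sub_one hnr.ne', sub_sub_cancel]
    calc (P.card : ℝ) * Real.log ((n : ℝ) / (n - P.card))
        ≤ P.card * (P.card / (n - P.card)) := mul_le_mul_of_nonneg_left hlog (Nat.cast_nonneg _)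
      _ = (P.card : ℝ) ^ 2 / (n - P.card) := by ring
      _ ≤ 1 := by
          rw [div_le_one hnr]
          linarith
  /- (5) assemble -/
  rw [hL] at hcert
  linarith [hsum_low, hB1, hB2, hcert]

/-- **Entropy certificate on level blocks (F4).**  Let `X, Y ⊆ S_n` (`n ≥ 2`) be non-empty with
`(x,y) ↦ x⁻¹y` injective on `X × Y`, profile `d(i,j) = #{(x,y) ∈ X × Y : y j = x i}/(|X||Y|)` and
threshold `θ > 0`.  For an atom `p = (k, ℓ)` (position `k : Fin n`, dyadic level `ℓ : Fin m`) let
`Blk p = {i : θ ≤ d(i,k), ⌊log₂ (1/d(i,k))⌋₊ = ℓ}` be its level block, `σ p = ∑_{i ∈ Blk p} d(i,k)`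
its mass and `x p = max |Blk p| 1` its width.  If `Inc` is a finite set of atoms with `σ p ≥ ε > 0`
on `Inc`, total mass `S = ∑_{Inc} σ p`, and its position set `P` satisfies `2|P|² ≤ n`, then
`∑_{p ∈ Inc} σ p (log n − log x p) ≤ log (n!/(|X||Y|)) + S log (S/ε) + 2`.
Proof: the quotient set `A = X⁻¹Y` has `|A| = |X||Y|` and profile `d` (`card_image₂_of_injOn'`,
`pairMarginal_eq_marginal_image₂`); level blocks at one position are disjoint for distinct levels,
so `certificate_blocks` applies. [folklore] -/
theorem certificate_levels {n m : ℕ} (hn : 2 ≤ n) (X Y : Finset (Equiv.Perm (Fin n)))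
    (hX : X.Nonempty) (hY : Y.Nonempty)
    (hinj : Set.InjOn (fun xy : Equiv.Perm (Fin n) × Equiv.Perm (Fin n) => xy.1⁻¹ * xy.2)
      (↑X ×ˢ ↑Y : Set (Equiv.Perm (Fin n) × Equiv.Perm (Fin n))))
    (d : Fin n → Fin n → ℝ)
    (hd : ∀ i j, d i j =
      (((X ×ˢ Y).filter fun xy => xy.2 j = xy.1 i).card : ℝ) / (X.card * Y.card : ℕ))
    (θ : ℝ) (hθ : 0 < θ) (Inc : Finset (Fin n × Fin m)) (ε : ℝ) (hε : 0 < ε)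
    (hεσ : ∀ p ∈ Inc, ε ≤ ∑ i ∈ Finset.univ.filter
      (fun i => θ ≤ d i p.1 ∧ ⌊Real.logb 2 (1 / d i p.1)⌋₊ = p.2.val), d i p.1)
    (hP : 2 * ((Inc.image Prod.fst).card : ℝ) ^ 2 ≤ n) :
    ∑ p ∈ Inc, (∑ i ∈ Finset.univ.filter
        (fun i => θ ≤ d i p.1 ∧ ⌊Real.logb 2 (1 / d i p.1)⌋₊ = p.2.val), d i p.1) *
      (Real.log n - Real.log (max ((Finset.univ.filter
        (fun i => θ ≤ d i p.1 ∧ ⌊Real.logb 2 (1 / d i p.1)⌋₊ = p.2.val)).card : ℝ) 1)) ≤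
    Real.log ((n.factorial : ℝ) / (X.card * Y.card : ℕ)) +
      (∑ p ∈ Inc, ∑ i ∈ Finset.univ.filter
        (fun i => θ ≤ d i p.1 ∧ ⌊Real.logb 2 (1 / d i p.1)⌋₊ = p.2.val), d i p.1) *
        Real.log ((∑ p ∈ Inc, ∑ i ∈ Finset.univ.filter
          (fun i => θ ≤ d i p.1 ∧ ⌊Real.logb 2 (1 / d i p.1)⌋₊ = p.2.val), d i p.1) / ε) +
      2 := by
  -- the threshold `θ > 0` is part of the registered interface; the certificate does not use it
  have _ := hθ
  -- the quotient set `A = X⁻¹Y` and the dictionary `d(i,j) = #{a ∈ A : a j = i}/|A|`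
  set A : Finset (Equiv.Perm (Fin n)) :=
    Finset.image₂ (fun x y : Equiv.Perm (Fin n) => x⁻¹ * y) X Y with hA_def
  have hA : A.Nonempty := hX.image₂ hY
  have hcard : A.card = X.card * Y.card := card_image₂_of_injOn' hinj
  have hd' : ∀ i j, d i j = ((A.filter fun a => a j = i).card : ℝ) / A.card := fun i j => by
    rw [hd i j, hcard]
    congr 1
    exact_mod_cast pairMarginal_eq_marginal_image₂ hinj i j
  -- two level blocks at the same position sharing a value have the same level
  have hB : ∀ p q : Fin n × Fin m, p.1 = q.1 →
      ∀ i ∈ Finset.univ.filter (fun i => θ ≤ d i p.1 ∧ ⌊Real.logb 2 (1 / d i p.1)⌋₊ = p.2.val),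
        i ∈ Finset.univ.filter (fun i => θ ≤ d i q.1 ∧ ⌊Real.logb 2 (1 / d i q.1)⌋₊ = q.2.val) →
          p = q := by
    intro p q hpq i hip hiq
    simp only [Finset.mem_filter, Finset.mem_univ, true_and] at hip hiq
    rw [hpq] at hip
    exact Prod.ext hpq (Fin.ext (hip.2.symm.trans hiq.2))
  have hcast : ((X.card * Y.card : ℕ) : ℝ) = A.card := by
    rw [hcard]
  rw [hcast]
  exact certificate_blocks hn A hA d hd'
    (fun p => Finset.univ.filter fun i => θ ≤ d i p.1 ∧ ⌊Real.logb 2 (1 / d i p.1)⌋₊ = p.2.val)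
    hB Inc ε hε hεσ hP

end Summit.MatrixMultiplication.MatrixMultiplication.Theorems.PolynomialSlack
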